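import Summits.Ventures.PercRepro.S1TriangleSevenF

/-!
# PercRepro — LEMMA Q‴: the triangle table from `P(7) = 11` (p2, gen 17)

The recursion of LEMMA Q restarted at the theorem `s₃ ≤ 11` at nullity `7` (S1TriangleSevenF): `cq2 d` is the table
`0, 1, 2, 4, 5, 7, 10, 11, 14, 17, 21, 25, 30, 36, 42, 49, 57, 66, 75, 85, 96, 108, 121, 135, 150, 166, 183, 201,
221, 242` for `d ≤ 29` and `cq d` beyond (`cq2 ≤ cq` everywhere). (The cell `(9, 16)` that it closes is S1CellNineSixteen.)

* `cq2`, `cq2_le_cq`, `cq2_eq_cq_of_le_six`, `cq2_step` — the table and its finite check;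
* **`ncard_triangles_le_cq2`**, `core_ncard_triangles_le_cq2`.
Axioms: standard.
-/

open scoped Matroid

namespace PercRepro

namespace S1

open Set

variable {α : Type}

/-- `cq2 d`: the triangle bound at nullity `d` from `P(7) = 11` (the table for `d ≤ 29`, `cq d` beyond). -/
def cq2 (d : ℕ) : ℕ :=
  if d ≤ 29 then
    [0, 1, 2, 4, 5, 7, 10, 11, 14, 17, 21, 25, 30, 36, 42, 49, 57, 66, 75, 85, 96, 108, 121, 135, 150, 166,
      183, 201, 221, 242].getD d 0
  else cq d

/-- `cq2 ≤ cq`. -/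
theorem cq2_le_cq (d : ℕ) : cq2 d ≤ cq d := by
  unfold cq2
  split_ifs with h
  · unfold cq; rw [if_pos h]; interval_cases d <;> decide
  · exact le_rfl

/-- `cq2 d = cq d` for `d ≤ 6`. -/
theorem cq2_eq_cq_of_le_six {d : ℕ} (hd : d ≤ 6) : cq2 d = cq d := by
  unfold cq2 cq
  rw [if_pos (by omega), if_pos (by omega)]
  interval_cases d <;> rfl

/-- **The finite check of the restarted recursion**: for `7 ≤ d ≤ 28`, every `s ≤ 4·cq2 d` with
`s ≤ ⌊3s / m0 (d + 1)⌋ + cq2 d` satisfies `s ≤ cq2 (d + 1)`. -/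
theorem cq2_step : ∀ d < 29, 7 ≤ d →
    ∀ s < 4 * cq2 d + 1, s ≤ 3 * s / m0 (d + 1) + cq2 d → s ≤ cq2 (d + 1) := by
  decide +kernel

/-- **LEMMA Q‴.** Under (C1), (C2), (C3), a finite matroid with `|E| = r(E) + d` has at most `cq2 d` triangles. -/
theorem ncard_triangles_le_cq2 (M : Matroid α) [M.Finite]
    (hC1 : ∀ L ⊆ M.E, M.eRk L = 2 → L.ncard ≤ 3) (hC2 : ∀ P ⊆ M.E, M.eRk P ≤ 3 → P.ncard ≤ 6)
    (hC3 : ∀ X ⊆ M.E, M.eRk X ≤ 4 → X.ncard ≤ 10) {d : ℕ} (hd : M.E.encard = M.eRank + d) :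
    (ThmN.triangles M).ncard ≤ cq2 d := by
  suffices H : ∀ n : ℕ, ∀ (M : Matroid α) [M.Finite], M.E.ncard = n →
      (∀ L ⊆ M.E, M.eRk L = 2 → L.ncard ≤ 3) → (∀ P ⊆ M.E, M.eRk P ≤ 3 → P.ncard ≤ 6) →
      (∀ X ⊆ M.E, M.eRk X ≤ 4 → X.ncard ≤ 10) →
      ∀ d : ℕ, M.E.encard = M.eRank + d → (ThmN.triangles M).ncard ≤ cq2 d from
    H _ M rfl hC1 hC2 hC3 d hd
  intro n
  induction n using Nat.strong_induction_on with
  | _ n ih =>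
  intro M _ hn hC1 hC2 hC3 d hd
  classical
  -- LEMMA Q covers `d ≤ 6` and `d ≥ 30`
  by_cases hd30 : 30 ≤ d
  · have : cq2 d = cq d := by unfold cq2; rw [if_neg (by omega)]
    rw [this]
    exact ncard_triangles_le_cq M hC1 hC2 hC3 hd
  by_cases hd6 : d ≤ 6
  · rw [cq2_eq_cq_of_le_six hd6]
    exact ncard_triangles_le_cq M hC1 hC2 hC3 hd
  -- `d = 7` is the theorem `P(7) = 11`
  by_cases hd7 : d = 7
  · subst hd7
    have : cq2 7 = 11 := by decide
    rw [this]
    exact ncard_triangles_le_eleven_of_nullity_seven M hC1 hC2 hC3 hd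
  -- `8 ≤ d ≤ 29` from here; if there is no triangle, nothing to prove
  by_cases hs0 : (ThmN.triangles M).ncard = 0
  · rw [hs0]; exact Nat.zero_le _
  have hSfin : (ThmN.triangles M).Finite :=
    M.ground_finite.finite_subsets.subset (fun C hC => hC.1.subset_ground)
  obtain ⟨C, hC⟩ : (ThmN.triangles M).Nonempty := by
    rw [← Set.ncard_pos hSfin]; omega
  obtain ⟨r, hr, hnr, hr2⟩ := two_add_le_eRank_of_triangle M hd hC
  have hE2 : r ≠ 2 ∨ M.E.ncard ≤ 3 := by
    by_cases h : r = 2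
    · refine Or.inr (hC1 M.E (subset_refl _) ?_)
      rw [← _root_.Matroid.eRank_def, hr, h]; norm_num
    · exact Or.inl h
  have hE3 : r ≠ 3 ∨ M.E.ncard ≤ 6 := by
    by_cases h : r = 3
    · refine Or.inr (hC2 M.E (subset_refl _) ?_)
      rw [← _root_.Matroid.eRank_def, hr, h]; norm_num
    · exact Or.inl h
  have hE4 : r ≠ 4 ∨ M.E.ncard ≤ 10 := by
    by_cases h : r = 4
    · refine Or.inr (hC3 M.E (subset_refl _) ?_)
      rw [← _root_.Matroid.eRank_def, hr, h]; norm_num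
    · exact Or.inl h
  have hm0 : m0 d ≤ M.E.ncard := by
    unfold m0
    split_ifs <;> omega
  -- a coloop: delete it and use the induction hypothesis
  by_cases hcol : ∃ k ∈ M.E, M.IsColoop k
  · obtain ⟨k, hkE, hk⟩ := hcol
    have hlt : (M ＼ {k}).E.ncard < n := by
      rw [_root_.Matroid.delete_ground, ← hn]
      exact Set.ncard_sdiff_singleton_lt_of_mem hkE M.ground_finite
    have hC1' : ∀ L ⊆ (M ＼ {k}).E, (M ＼ {k}).eRk L = 2 → L.ncard ≤ 3 := by
      intro L hL hr
      rw [_root_.Matroid.delete_ground] at hL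
      rw [delete_singleton_eRk_eq hL] at hr
      exact hC1 L (hL.trans Set.sdiff_subset) hr
    have hC2' : ∀ P ⊆ (M ＼ {k}).E, (M ＼ {k}).eRk P ≤ 3 → P.ncard ≤ 6 := by
      intro P hP hr
      rw [_root_.Matroid.delete_ground] at hP
      rw [delete_singleton_eRk_eq hP] at hr
      exact hC2 P (hP.trans Set.sdiff_subset) hr
    have hC3' : ∀ X ⊆ (M ＼ {k}).E, (M ＼ {k}).eRk X ≤ 4 → X.ncard ≤ 10 := by
      intro X hX hr
      rw [_root_.Matroid.delete_ground] at hX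
      rw [delete_singleton_eRk_eq hX] at hr
      exact hC3 X (hX.trans Set.sdiff_subset) hr
    have hd' : (M ＼ {k}).E.encard = (M ＼ {k}).eRank + d := encard_delete_eq_of_isColoop M hk hd
    have := ih _ hlt (M ＼ {k}) rfl hC1' hC2' hC3' d hd'
    rwa [triangles_delete_eq_of_isColoop M hk] at this
  have hcol' : ∀ x ∈ M.E, ¬ M.IsColoop x := fun x hx h => hcol ⟨x, hx, h⟩
  -- the coloop-free step: a point of degree `≤ ⌊3·s₃/m⌋` exists
  have hm4 : 4 ≤ M.E.ncard := (four_le_m0 (by omega)).trans hm0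
  obtain ⟨x, hxE, hx⟩ : ∃ x ∈ M.E,
      (ThmN.trianglesThrough M x).ncard ≤ 3 * (ThmN.triangles M).ncard / M.E.ncard := by
    by_contra hno
    have hall : ∀ x ∈ M.E,
        3 * (ThmN.triangles M).ncard / M.E.ncard + 1 ≤ (ThmN.trianglesThrough M x).ncard := by
      intro x hx
      by_contra h
      exact hno ⟨x, hx, by omega⟩
    have h1 := mul_ncard_ground_le_three_mul_ncard_triangles M
      (3 * (ThmN.triangles M).ncard / M.E.ncard + 1) hall
    have h2 : 3 * (ThmN.triangles M).ncard <
        (3 * (ThmN.triangles M).ncard / M.E.ncard + 1) * M.E.ncard :=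
      Nat.lt_mul_of_div_lt (Nat.lt_succ_self _) (by omega)
    omega
  -- delete `x`: nullity `d − 1`, at most `cq2 (d − 1)` triangles
  obtain ⟨d', rfl⟩ : ∃ d', d = d' + 1 := ⟨d - 1, by omega⟩
  obtain ⟨hd', hC1', hC2', hle⟩ :=
    ncard_triangles_le_add_of_not_isColoop M hC1 hC2 (d := d') hd hxE (hcol' x hxE)
  have hC3' : ∀ X ⊆ (M ＼ {x}).E, (M ＼ {x}).eRk X ≤ 4 → X.ncard ≤ 10 := by
    intro X hX hr
    rw [_root_.Matroid.delete_ground] at hX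
    rw [delete_singleton_eRk_eq hX] at hr
    exact hC3 X (hX.trans Set.sdiff_subset) hr
  have hlt : (M ＼ {x}).E.ncard < n := by
    rw [_root_.Matroid.delete_ground, ← hn]
    exact Set.ncard_sdiff_singleton_lt_of_mem hxE M.ground_finite
  have hrec := ih _ hlt (M ＼ {x}) rfl hC1' hC2' hC3' d' hd'
  -- `s ≤ ⌊3s/m⌋ + cq2 d' ≤ ⌊3s/m0⌋ + cq2 d'`
  have hm0pos : 0 < m0 (d' + 1) := by have := four_le_m0 (d := d' + 1) (by omega); omega
  have hdiv : 3 * (ThmN.triangles M).ncard / M.E.ncard ≤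
      3 * (ThmN.triangles M).ncard / m0 (d' + 1) := Nat.div_le_div_left hm0 hm0pos
  have hkey : (ThmN.triangles M).ncard ≤ 3 * (ThmN.triangles M).ncard / m0 (d' + 1) + cq2 d' := by
    omega
  -- `s ≤ 4·cq2 d'` since `m0 ≥ 4`
  have h4 : 3 * (ThmN.triangles M).ncard / m0 (d' + 1) ≤ 3 * (ThmN.triangles M).ncard / 4 :=
    Nat.div_le_div_left (four_le_m0 (by omega)) (by norm_num)
  have hs4 : (ThmN.triangles M).ncard ≤ 4 * cq2 d' := by
    have := Nat.div_mul_le_self (3 * (ThmN.triangles M).ncard) 4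
    omega
  exact cq2_step d' (by omega) (by omega) _ (by omega) hkey

/-- **LEMMA Q‴ on the `e`-free core.** -/
theorem core_ncard_triangles_le_cq2 (M : Matroid α) [M.Finite]
    (hfree : ∀ e ∈ M.E, ∃ A ⊆ M.E \ {e}, e ∉ M.closure A ∧ e ∉ M.closure ((M.E \ {e}) \ A))
    {d : ℕ} (hd : M.E.encard = M.eRank + d) :
    {C : Set α | M.IsCircuit C ∧ C.ncard = 3}.ncard ≤ cq2 d := by
  have hL : ∀ e ∈ M.E, ¬ M.IsLoop e := ThmN.not_isLoop_of_free M hfree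
  have hline : ∀ L ⊆ M.E, M.eRk L = 2 → L.ncard ≤ 3 := by
    intro L hL' hr
    have := ThmN.ncard_add_one_le_two_pow_of_eRk_le M hL hfree 2 L hL' hr.le
    omega
  have hplane : ∀ P ⊆ M.E, M.eRk P ≤ 3 → P.ncard ≤ 6 := fun P hP hr =>
    ThmN.ncard_le_six_of_eRk_le_three_of_free M hfree hP hr
  have hsolid : ∀ X ⊆ M.E, M.eRk X ≤ 4 → X.ncard ≤ 10 := fun X hX hr =>
    ThmN.ncard_le_ten_of_eRk_le_four_of_free M hfree hX hr
  exact ncard_triangles_le_cq2 M hline hplane hsolid hd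

end S1

end PercRepro
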